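import Literature.NumberTheory.QuadraticFields.ScholzHeckeUnitCriterion
import Literature.NumberTheory.QuadraticFields.RealQuadraticRegulator
import Mathlib.NumberTheory.Pell
import Mathlib.NumberTheory.NumberField.Units.Regulator

/-!
# The mirror unit data (stub `stub_mirrorUnitData` of line `mirror-unit-signature`, crux
# `ArithStatLadder.AvgFaceBeyondPrior`, stmt-QuantumAdvantage-2427)

For `−d` a negative fundamental discriminant with `d ≠ 3`, let `d₀ = mirrorRadicand d` be the square-free
kernel of `3d` (so `ℚ(√d₀) = ℚ(√3d)` is the mirror field). We prove (`stub_mirrorUnitData`):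

1. `d₀` is square-free and `≥ 2` (case analysis on the literal fundamental predicate);
2. THE fundamental solution `(a, b)` in the sense of `IsMirrorFundUnit d a b` (`0 < b`,
   `a² − d₀ b² = ±4`, `a` least) exists (Pell's equation, `Nat.find`) and is unique (for a fixed `a` the
   two signs cannot both occur with positive `b`, and a fixed sign determines `b`);
3. for every quadratic number field `K ∋ √d₀`, `log ((a + b√d₀)/2) = regulator K`
   (`Quadratic.exists_regulator_eq_log`: the regulator is the logarithm of the least `(X + Y√D)/2 > 1`,
   `X, Y ≥ 1`, `X² − DY² = ±4`, `D = fundDiscr d₀ ∈ {d₀, 4d₀}`; the least `a` gives the least value because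
   `a ≤ a'` forces `b ≤ b'` among solutions, and for `D = 4d₀` every solution of `a² − d₀b² = ±4` has `b`
   even), hence `|log ((a + b√d₀)/2) − r| < 1` for `r ∈ {⌊R⌋₊, ⌈R⌉₊}`.

These are exactly the promises of `Hallgren2007_regulator_qsolvable_delim` (input `d₀` square-free `≥ 2`)
and of `JacobsonWilliams2008_unitResidue_mem_FP` (the least solution and a unit-distance approximation
of its logarithm) consumed by the neighbouring stub `stub_oracleLangMemBQP`.

Theorem-only file; elementary arithmetic throughout (no unit structure theorem is used: the comparison
of solutions is done on the coordinates `(a, b)` directly).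
-/

noncomputable section

-- the summit-side namespace `Summit.QuantumAdvantage.QuantumAdvantage.…` (summit = problem) is mandated by the layout
set_option linter.dupNamespace false

namespace Summit.QuantumAdvantage.QuantumAdvantage.Theorems.AvgFaceBeyondPrior.Mirror

open Literature.NumberTheory.QuadraticFields

/-! ### (i) The mirror radicand is square-free and at least `2` -/

/-- For `−d` fundamental and `d ≠ 3`, `d₀ = mirrorRadicand d` is square-free and `≥ 2`:
`d ≡ 3 (mod 4)` square-free gives `d₀ ∈ {d/3, 3d}`, `d = 4m` with `m ≡ 1, 2 (mod 4)` square-free gives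
`d₀ ∈ {m/3, 3m}`; `d₀ = 1` would force `d = 3` or `−d = −12` (not fundamental). [folklore] -/
theorem squarefree_two_le_mirrorRadicand {d : ℕ}
    (hd : (((-(d:ℤ)) % 4 = 1 ∧ Squarefree (-(d:ℤ)) ∧ (-(d:ℤ)) ≠ 1) ∨
      (4 ∣ (-(d:ℤ)) ∧ ((-(d:ℤ)) / 4 % 4 = 2 ∨ (-(d:ℤ)) / 4 % 4 = 3) ∧ Squarefree ((-(d:ℤ)) / 4))))
    (h3 : d ≠ 3) : Squarefree (mirrorRadicand d) ∧ 2 ≤ mirrorRadicand d := by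
  have h3sf : Squarefree (3 : ℕ) := Nat.prime_three.prime.squarefree
  have hmul : ∀ m : ℕ, ¬ 3 ∣ m → Squarefree m → Squarefree (3 * m) := fun m hm hsq =>
    (Nat.squarefree_mul ((Nat.Prime.coprime_iff_not_dvd Nat.prime_three).2 hm)).2 ⟨h3sf, hsq⟩
  rcases hd with ⟨h1, h2, -⟩ | ⟨h4, h2, hsq⟩
  · have hsqd : Squarefree d := by
      rw [← Int.squarefree_natAbs, Int.natAbs_neg, Int.natAbs_natCast] at h2; exact h2
    have h4 : ¬ 4 ∣ d := by omega
    by_cases h3d : 3 ∣ d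
    · have hr : mirrorRadicand d = d / 3 := by unfold mirrorRadicand; rw [if_pos h3d, if_neg h4]
      rw [hr]
      exact ⟨hsqd.squarefree_of_dvd (Nat.div_dvd_of_dvd h3d), by omega⟩
    · have hr : mirrorRadicand d = 3 * d := by unfold mirrorRadicand; rw [if_neg h3d, if_neg h4]
      rw [hr]
      exact ⟨hmul d h3d hsqd, by omega⟩
  · have hq : (-(d:ℤ)) / 4 = -((d / 4 : ℕ) : ℤ) := by omega
    have hsqm : Squarefree (d / 4) := by
      rw [hq, ← Int.squarefree_natAbs, Int.natAbs_neg, Int.natAbs_natCast] at hsq; exact hsq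
    have h4d : 4 ∣ d := by omega
    by_cases h3d : 3 ∣ d
    · have hr : mirrorRadicand d = d / 4 / 3 := by
        unfold mirrorRadicand; rw [if_pos h3d, if_pos h4d]; omega
      rw [hr]
      have h3m : 3 ∣ d / 4 := by omega
      exact ⟨hsqm.squarefree_of_dvd (Nat.div_dvd_of_dvd h3m), by omega⟩
    · have hr : mirrorRadicand d = 3 * (d / 4) := by
        unfold mirrorRadicand; rw [if_neg h3d, if_pos h4d]
      rw [hr]
      exact ⟨hmul (d / 4) (by omega) hsqm, by omega⟩

/-! ### (ii) Solutions of `a² − n b² = ±4` for square-free `n ≥ 2` -/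

/-- A solution of `a² − n b² = ±4` with `b > 0` (`n ≥ 2` square-free) has `a ≥ 1`: `a = 0` would give
`n b² = 4`, i.e. `n = 4`. [folklore] -/
theorem one_le_of_sol {n a b : ℕ} (hsf : Squarefree n) (h2 : 2 ≤ n) (hb : 0 < b)
    (h : (a:ℤ) ^ 2 - (n:ℤ) * (b:ℤ) ^ 2 = 4 ∨ (a:ℤ) ^ 2 - (n:ℤ) * (b:ℤ) ^ 2 = -4) : 1 ≤ a := by
  by_contra ha
  have ha0 : (a:ℤ) = 0 := by exact_mod_cast (show a = 0 by omega)
  have ha2 : (a:ℤ) ^ 2 = 0 := by rw [ha0]; norm_num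
  have hb1 : (1:ℤ) ≤ b := by exact_mod_cast hb
  have hn2 : (2:ℤ) ≤ n := by exact_mod_cast h2
  have hpos : (0:ℤ) ≤ (n:ℤ) * (b:ℤ) ^ 2 := by positivity
  have hnb : (n:ℤ) * (b:ℤ) ^ 2 = 4 := by rcases h with h | h <;> linarith
  have hb1' : (b:ℤ) = 1 := by
    by_contra hb1'
    have : (2:ℤ) ≤ b := by omega
    nlinarith
  have hbsq : (b:ℤ) ^ 2 = 1 := by rw [hb1']; norm_num
  rw [hbsq, mul_one] at hnb
  have hn4 : n = 4 := by exact_mod_cast hnb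
  subst hn4
  have := Nat.isUnit_iff.1 (hsf 2 (by norm_num))
  omega

/-- For a fixed `a`, the equations `a² − n b² = 4` (with `b > 0`) and `a² − n b'² = −4` cannot both hold
(`n ≥ 2` square-free): subtracting gives `n ∣ 8`, so `n = 2` and `b'² − b² = 4`, impossible. [folklore] -/
theorem not_sol_four_of_sol_neg_four {n a b b' : ℕ} (hsf : Squarefree n) (h2 : 2 ≤ n) (hb : 0 < b)
    (h : (a:ℤ) ^ 2 - (n:ℤ) * (b:ℤ) ^ 2 = 4) (h' : (a:ℤ) ^ 2 - (n:ℤ) * (b':ℤ) ^ 2 = -4) : False := by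
  have h8 : (n:ℤ) * ((b':ℤ) ^ 2 - (b:ℤ) ^ 2) = 8 := by linear_combination h - h'
  have hdvd : n ∣ 8 := by
    have : (n:ℤ) ∣ 8 := ⟨_, h8.symm⟩
    exact_mod_cast this
  have hn8 : n ≤ 8 := Nat.le_of_dvd (by norm_num) hdvd
  have h4 : ¬ 2 * 2 ∣ n := fun h4 => by
    have := Nat.isUnit_iff.1 (hsf 2 h4)
    omega
  have hn : n = 2 := by interval_cases n <;> omega
  subst hn
  have hE : (b':ℤ) ^ 2 = (b:ℤ) ^ 2 + 4 := by push_cast at h8; linarith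
  have hb1 : (1:ℤ) ≤ b := by exact_mod_cast hb
  have hb'0 : (0:ℤ) ≤ b' := by positivity
  have hlt : (b:ℤ) < b' := by nlinarith
  have hlt2 : (b':ℤ) < b + 2 := by nlinarith
  have hb' : (b':ℤ) = b + 1 := by omega
  rw [hb'] at hE
  have : 2 * (b:ℤ) = 3 := by linear_combination hE
  omega

/-- **`a ≤ a'` forces `b ≤ b'`** among solutions of `a² − n b² = ±4` with `b, b' > 0` (`n ≥ 2`
square-free). The only non-monotone configuration, sign `−` at `a` against sign `+` at `a' ≥ a + 1` with
`b ≥ b' + 1`, gives `2a + 2nb' + n ≤ 7`, impossible. Hence the least `a` gives the least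
`(a + b√n)/2`. [folklore] -/
theorem le_of_sol_of_le {n a b a' b' : ℕ} (hsf : Squarefree n) (h2 : 2 ≤ n) (hb : 0 < b) (hb' : 0 < b')
    (h : (a:ℤ) ^ 2 - (n:ℤ) * (b:ℤ) ^ 2 = 4 ∨ (a:ℤ) ^ 2 - (n:ℤ) * (b:ℤ) ^ 2 = -4)
    (h' : (a':ℤ) ^ 2 - (n:ℤ) * (b':ℤ) ^ 2 = 4 ∨ (a':ℤ) ^ 2 - (n:ℤ) * (b':ℤ) ^ 2 = -4)
    (hle : a ≤ a') : b ≤ b' := by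
  by_contra hlt
  have hbb : (b':ℤ) + 1 ≤ b := by exact_mod_cast (show b' + 1 ≤ b by omega)
  have hb'1 : (1:ℤ) ≤ b' := by exact_mod_cast hb'
  have hn2 : (2:ℤ) ≤ n := by exact_mod_cast h2
  have hsq : ((b':ℤ) + 1) ^ 2 ≤ (b:ℤ) ^ 2 := by nlinarith
  have hstar : (n:ℤ) * (b':ℤ) ^ 2 + 2 * ((n:ℤ) * b') + n ≤ (n:ℤ) * (b:ℤ) ^ 2 := by
    have := mul_le_mul_of_nonneg_left hsq (by positivity : (0:ℤ) ≤ n)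
    nlinarith [this]
  have hnb' : (2:ℤ) ≤ (n:ℤ) * b' := by nlinarith
  have ha0 : (0:ℤ) ≤ a := by positivity
  have haa : (a:ℤ) ≤ a' := by exact_mod_cast hle
  have haa2 : (a:ℤ) ^ 2 ≤ (a':ℤ) ^ 2 := by nlinarith
  rcases h with h | h <;> rcases h' with h' | h'
  · linarith
  · linarith
  · rcases eq_or_lt_of_le hle with heq | hlt'
    · subst heq
      exact not_sol_four_of_sol_neg_four hsf h2 hb' h' h
    · have h1 : (a:ℤ) + 1 ≤ a' := by exact_mod_cast hlt'
      have h1' : ((a:ℤ) + 1) ^ 2 ≤ (a':ℤ) ^ 2 := by nlinarith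
      have ha1 : (1:ℤ) ≤ a := by exact_mod_cast one_le_of_sol hsf h2 hb (Or.inr h)
      linarith
  · linarith

/-- **Existence of the least solution** (`n ≥ 2` square-free): Pell's equation `x² − n y² = 1`
(`Pell.exists_of_not_isSquare`) gives the solution `(2|x|, 2|y|)`, and `Nat.find` the least `a`.
[folklore] -/
theorem exists_least_sol {n : ℕ} (hsf : Squarefree n) (h2 : 2 ≤ n) :
    ∃ a b : ℕ, 0 < b ∧ ((a:ℤ) ^ 2 - (n:ℤ) * (b:ℤ) ^ 2 = 4 ∨ (a:ℤ) ^ 2 - (n:ℤ) * (b:ℤ) ^ 2 = -4) ∧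
      ∀ a' b' : ℕ, 0 < b' →
        ((a':ℤ) ^ 2 - (n:ℤ) * (b':ℤ) ^ 2 = 4 ∨ (a':ℤ) ^ 2 - (n:ℤ) * (b':ℤ) ^ 2 = -4) → a ≤ a' := by
  classical
  have hne : ∃ a b : ℕ, 0 < b ∧
      ((a:ℤ) ^ 2 - (n:ℤ) * (b:ℤ) ^ 2 = 4 ∨ (a:ℤ) ^ 2 - (n:ℤ) * (b:ℤ) ^ 2 = -4) := by
    obtain ⟨x, y, hxy, hy⟩ := Pell.exists_of_not_isSquare (d := (n:ℤ)) (by positivity)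
      (Quadratic.not_isSquare_intCast_of_squarefree hsf h2)
    refine ⟨(2 * x).natAbs, (2 * y).natAbs, Int.natAbs_pos.2 (by omega), Or.inl ?_⟩
    rw [Int.natCast_natAbs, Int.natCast_natAbs, sq_abs, sq_abs]
    linear_combination 4 * hxy
  refine ⟨Nat.find hne, ?_⟩
  obtain ⟨b, hb, hsol⟩ := Nat.find_spec hne
  exact ⟨b, hb, hsol, fun a' b' hb' h' => Nat.find_min' hne ⟨b', hb', h'⟩⟩

/-! ### (iii) Transport to the discriminant form `X² − D Y² = ±4`, `D = fundDiscr n` -/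

/-- For `n ≡ 2, 3 (mod 4)`, every solution of `a² − n b² = ±4` has `b` even (`b` odd gives
`a² ≡ n (mod 4)`, not a square residue). [folklore] -/
theorem two_dvd_of_sol {n a b : ℕ} (h4 : n % 4 = 2 ∨ n % 4 = 3)
    (h : (a:ℤ) ^ 2 - (n:ℤ) * (b:ℤ) ^ 2 = 4 ∨ (a:ℤ) ^ 2 - (n:ℤ) * (b:ℤ) ^ 2 = -4) : 2 ∣ b := by
  by_contra hodd
  obtain ⟨m, hm⟩ : ∃ m, b = 2 * m + 1 := ⟨b / 2, by omega⟩
  obtain ⟨k, hk⟩ := Nat.even_or_odd' a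
  have key : (n:ℤ) * (b:ℤ) ^ 2 = 4 * ((n:ℤ) * ((m:ℤ) * m + m)) + n := by
    rw [hm]; push_cast; ring
  rw [key] at h
  rcases hk with hk | hk
  · have ha2 : (a:ℤ) ^ 2 = 4 * ((k:ℤ) * k) := by rw [hk]; push_cast; ring
    rw [ha2] at h
    omega
  · have ha2 : (a:ℤ) ^ 2 = 4 * ((k:ℤ) * k + k) + 1 := by rw [hk]; push_cast; ring
    rw [ha2] at h
    omega

/-- From a solution `X, Y ≥ 1` of `X² − D Y² = ±4`, `D = fundDiscr n`, a solution `(a', b')` of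
`a'² − n b'² = ±4` with `b' > 0` and the same value `(X + Y√D)/2 = (a' + b'√n)/2`
(`(a', b') = (X, Y)` if `D = n`, `(X, 2Y)` if `D = 4n`). [folklore] -/
theorem sol_of_fundDiscr_sol {n : ℕ} {X Y : ℤ} (hX : 1 ≤ X) (hY : 1 ≤ Y)
    (hXY : X ^ 2 - Quadratic.fundDiscr n * Y ^ 2 = 4 ∨ X ^ 2 - Quadratic.fundDiscr n * Y ^ 2 = -4) :
    ∃ a' b' : ℕ, 0 < b' ∧
      ((a':ℤ) ^ 2 - (n:ℤ) * (b':ℤ) ^ 2 = 4 ∨ (a':ℤ) ^ 2 - (n:ℤ) * (b':ℤ) ^ 2 = -4) ∧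
      ((X:ℝ) + (Y:ℝ) * Real.sqrt (Quadratic.fundDiscr n)) / 2 =
        ((a':ℝ) + (b':ℝ) * Real.sqrt n) / 2 := by
  have hXn : ((X.toNat : ℕ) : ℤ) = X := Int.toNat_of_nonneg (by omega)
  have hXr : ((X.toNat : ℕ) : ℝ) = X := by exact_mod_cast hXn
  by_cases h4 : n % 4 = 1
  · rw [Quadratic.fundDiscr_of_mod_four_eq_one h4] at hXY ⊢
    have hYn : ((Y.toNat : ℕ) : ℤ) = Y := Int.toNat_of_nonneg (by omega)
    have hYr : ((Y.toNat : ℕ) : ℝ) = Y := by exact_mod_cast hYn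
    refine ⟨X.toNat, Y.toNat, by omega, by rw [hXn, hYn]; exact hXY, ?_⟩
    rw [hXr, hYr, Int.cast_natCast]
  · rw [Quadratic.fundDiscr_of_mod_four_ne_one h4] at hXY ⊢
    have hYn : (((2 * Y).toNat : ℕ) : ℤ) = 2 * Y := Int.toNat_of_nonneg (by omega)
    have hYr : (((2 * Y).toNat : ℕ) : ℝ) = 2 * Y := by exact_mod_cast hYn
    refine ⟨X.toNat, (2 * Y).toNat, by omega, ?_, ?_⟩
    · rw [hXn, hYn]
      have : (n:ℤ) * (2 * Y) ^ 2 = 4 * (n:ℤ) * Y ^ 2 := by ring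
      rw [this]; exact hXY
    · rw [hXr, hYr]
      have h4s : Real.sqrt ((4 * (n:ℤ) : ℤ) : ℝ) = 2 * Real.sqrt n := by
        push_cast
        rw [Real.sqrt_mul (by norm_num : (0:ℝ) ≤ 4), show (4:ℝ) = 2 ^ 2 by norm_num,
          Real.sqrt_sq (by norm_num : (0:ℝ) ≤ 2)]
      rw [h4s]; ring

/-- From a solution `(a, b)`, `b > 0`, of `a² − n b² = ±4` (`n ≥ 2` square-free), a solution `X, Y ≥ 1` of
`X² − D Y² = ±4`, `D = fundDiscr n`, with the same value (`(X, Y) = (a, b)` if `D = n`, `(a, b/2)` if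
`D = 4n`, `b` being even by `two_dvd_of_sol`). [folklore] -/
theorem fundDiscr_sol_of_sol {n a b : ℕ} (hsf : Squarefree n) (h2 : 2 ≤ n) (hb : 0 < b)
    (h : (a:ℤ) ^ 2 - (n:ℤ) * (b:ℤ) ^ 2 = 4 ∨ (a:ℤ) ^ 2 - (n:ℤ) * (b:ℤ) ^ 2 = -4) :
    ∃ X Y : ℤ, 1 ≤ X ∧ 1 ≤ Y ∧
      (X ^ 2 - Quadratic.fundDiscr n * Y ^ 2 = 4 ∨ X ^ 2 - Quadratic.fundDiscr n * Y ^ 2 = -4) ∧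
      ((X:ℝ) + (Y:ℝ) * Real.sqrt (Quadratic.fundDiscr n)) / 2 =
        ((a:ℝ) + (b:ℝ) * Real.sqrt n) / 2 := by
  have ha : 1 ≤ a := one_le_of_sol hsf h2 hb h
  by_cases h4 : n % 4 = 1
  · rw [Quadratic.fundDiscr_of_mod_four_eq_one h4]
    exact ⟨a, b, by exact_mod_cast ha, by exact_mod_cast hb, h, by simp only [Int.cast_natCast]⟩
  · rw [Quadratic.fundDiscr_of_mod_four_ne_one h4]
    have h40 : n % 4 ≠ 0 := fun h0 => by
      have := Nat.isUnit_iff.1 (hsf 2 (by omega))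
      omega
    obtain ⟨c, rfl⟩ := two_dvd_of_sol (by omega) h
    refine ⟨a, c, by exact_mod_cast ha, by omega, ?_, ?_⟩
    · have : 4 * (n:ℤ) * (c:ℤ) ^ 2 = (n:ℤ) * (((2 * c : ℕ) : ℤ)) ^ 2 := by push_cast; ring
      rw [this]; exact h
    · have h4s : Real.sqrt ((4 * (n:ℤ) : ℤ) : ℝ) = 2 * Real.sqrt n := by
        push_cast
        rw [Real.sqrt_mul (by norm_num : (0:ℝ) ≤ 4), show (4:ℝ) = 2 ^ 2 by norm_num,
          Real.sqrt_sq (by norm_num : (0:ℝ) ≤ 2)]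
      rw [h4s]; push_cast; ring

/-- **The least solution is the regulator**: for `n ≥ 2` square-free and `(a, b)` the least solution
(`b > 0`, `a² − n b² = ±4`, `a` least), `(a + b√n)/2 > 1` and `regulator K = log ((a + b√n)/2)` for every
quadratic number field `K ∋ √n` (`Quadratic.exists_regulator_eq_log` and `le_of_sol_of_le`).
[cite: Jozsa2003, §3 (Thm 3 and the definition of the regulator)] -/
theorem regulator_eq_log_least_sol {n a b : ℕ} (hsf : Squarefree n) (h2 : 2 ≤ n) (hb : 0 < b)
    (h : (a:ℤ) ^ 2 - (n:ℤ) * (b:ℤ) ^ 2 = 4 ∨ (a:ℤ) ^ 2 - (n:ℤ) * (b:ℤ) ^ 2 = -4)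
    (hmin : ∀ a' b' : ℕ, 0 < b' →
      ((a':ℤ) ^ 2 - (n:ℤ) * (b':ℤ) ^ 2 = 4 ∨ (a':ℤ) ^ 2 - (n:ℤ) * (b':ℤ) ^ 2 = -4) → a ≤ a')
    (K : Type) [Field K] [NumberField K] (hK : Module.finrank ℚ K = 2) (hα : ∃ α : K, α ^ 2 = (n : K)) :
    1 < ((a:ℝ) + (b:ℝ) * Real.sqrt n) / 2 ∧
      NumberField.Units.regulator K = Real.log (((a:ℝ) + (b:ℝ) * Real.sqrt n) / 2) := by
  obtain ⟨ε₀, hε₀, ⟨X, Y, hX, hY, hXY, hε⟩, hmin₀, hreg⟩ := Quadratic.exists_regulator_eq_log hsf h2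
  have hle1 : ((a:ℝ) + (b:ℝ) * Real.sqrt n) / 2 ≤ ε₀ := by
    obtain ⟨a', b', hb', h', hval⟩ := sol_of_fundDiscr_sol hX hY hXY
    rw [hε, hval]
    have hle : a ≤ a' := hmin a' b' hb' h'
    have hble : (b:ℝ) ≤ b' := by exact_mod_cast le_of_sol_of_le hsf h2 hb hb' h h' hle
    have hle' : (a:ℝ) ≤ a' := by exact_mod_cast hle
    have hs : 0 ≤ Real.sqrt n := Real.sqrt_nonneg _
    nlinarith [mul_le_mul_of_nonneg_right hble hs]
  have hle2 : ε₀ ≤ ((a:ℝ) + (b:ℝ) * Real.sqrt n) / 2 := by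
    obtain ⟨X₁, Y₁, hX₁, hY₁, hXY₁, hval⟩ := fundDiscr_sol_of_sol hsf h2 hb h
    rw [← hval]
    exact hmin₀ X₁ Y₁ hX₁ hY₁ hXY₁
  have heq : ((a:ℝ) + (b:ℝ) * Real.sqrt n) / 2 = ε₀ := le_antisymm hle1 hle2
  rw [heq]
  exact ⟨hε₀, hreg K hK hα⟩

/-- A nonnegative real is within `1` of its natural floor and of its natural ceiling. [folklore] -/
theorem abs_sub_lt_one_of_eq_floor_or_ceil {R : ℝ} (hR : 0 ≤ R) {r : ℕ} (hr : r = ⌊R⌋₊ ∨ r = ⌈R⌉₊) :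
    |R - (r:ℝ)| < 1 := by
  rcases hr with rfl | rfl
  · rw [abs_lt]
    constructor <;> linarith [Nat.floor_le hR, Nat.lt_floor_add_one R]
  · rw [abs_lt]
    constructor <;> linarith [Nat.le_ceil R, Nat.ceil_lt_add_one hR]

/-! ### The stub -/

/-- **The mirror unit data** (stub `stub_mirrorUnitData` of line `mirror-unit-signature`): for `−d`
fundamental, `d ≠ 3`, (i) `d₀ = mirrorRadicand d` is square-free and `≥ 2`; (ii) THE fundamental solution
`(a, b)` (`IsMirrorFundUnit d a b`: `b > 0`, `a² − d₀b² = ±4`, `a` least) exists and is unique; (iii) for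
every quadratic number field `K ∋ √d₀`, `log((a + b√d₀)/2)` is Mathlib's `regulator K`, hence within `1`
of `⌊R⌋₊` and of `⌈R⌉₊` — the promise of `JacobsonWilliams2008_unitResidue_mem_FP` on Hallgren's output
(`Hallgren2007_regulator_qsolvable_delim`). [cite: JacobsonWilliams2008, Ch. 12] -/
theorem stub_mirrorUnitData :
    ∀ d : ℕ, ((((-(d:ℤ)) % 4 = 1 ∧ Squarefree (-(d:ℤ)) ∧ (-(d:ℤ)) ≠ 1) ∨
        (4 ∣ (-(d:ℤ)) ∧ ((-(d:ℤ)) / 4 % 4 = 2 ∨ (-(d:ℤ)) / 4 % 4 = 3) ∧ Squarefree ((-(d:ℤ)) / 4)))) →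
      d ≠ 3 →
      Squarefree (mirrorRadicand d) ∧ 2 ≤ mirrorRadicand d ∧
      ∃ a b : ℕ, IsMirrorFundUnit d a b ∧
        (∀ a' b' : ℕ, IsMirrorFundUnit d a' b' → a' = a ∧ b' = b) ∧
        ∀ (K : Type) [Field K] [NumberField K], Module.finrank ℚ K = 2 →
          (∃ α : K, α ^ 2 = ((mirrorRadicand d : ℕ) : K)) →
          ∀ r : ℕ, (r = ⌊NumberField.Units.regulator K⌋₊ ∨ r = ⌈NumberField.Units.regulator K⌉₊) →
            |Real.log (((a : ℝ) + (b : ℝ) * Real.sqrt (mirrorRadicand d : ℕ)) / 2) - (r : ℝ)| < 1 := by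
  intro d hd h3
  obtain ⟨hsf, h2⟩ := squarefree_two_le_mirrorRadicand hd h3
  refine ⟨hsf, h2, ?_⟩
  obtain ⟨a, b, hb, h, hmin⟩ := exists_least_sol hsf h2
  refine ⟨a, b, ⟨hb, h, hmin⟩, ?_, ?_⟩
  · rintro a' b' ⟨hb', h', hmin'⟩
    have haa : a' = a := le_antisymm (hmin' a b hb h) (hmin a' b' hb' h')
    subst haa
    exact ⟨rfl, le_antisymm (le_of_sol_of_le hsf h2 hb' hb h' h le_rfl)
      (le_of_sol_of_le hsf h2 hb hb' h h' le_rfl)⟩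
  · intro K _ _ hK hα r hr
    obtain ⟨h1, hreg⟩ := regulator_eq_log_least_sol hsf h2 hb h hmin K hK hα
    rw [← hreg]
    exact abs_sub_lt_one_of_eq_floor_or_ceil (by rw [hreg]; exact (Real.log_pos h1).le) hr

end Summit.QuantumAdvantage.QuantumAdvantage.Theorems.AvgFaceBeyondPrior.Mirror

end
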